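import Summits.BirchSwinnertonDyer.BirchSwinnertonDyer.Theorems.SignedLowerHalvesSmallImageLowerHalfBothSignsRttD2SeqLocalCondition
import Summits.BirchSwinnertonDyer.BirchSwinnertonDyer.Theorems.SignedLowerHalvesSmallImageLowerHalfBothSignsRttCharRoadE2DualOStructure
import Summits.BirchSwinnertonDyer.BirchSwinnertonDyer.Theorems.SignedLowerHalvesSmallImageLowerHalfBothSignsRttCharRoadE2DualQuasiIso
import Literature.NumberTheory.EllipticCurves.AnticyclotomicSignedLocalConditions
import Literature.NumberTheory.EllipticCurves.IwasawaSelmerDualFunctorialityProofs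
import HarnessLib

/-!
# Route `SignedLowerHalves`, crux L `SmallImageLowerHalfBothSigns` (stmt-BirchSwinnertonDyer-23599), line `rtt_w3` v13 — E2, row D2-seq (1′),
# DEFINITIONS posited by the line (part 2/3): Pontryagin-dual data `DQ` for the saturated transported local condition group (`Q := DQ.X` with its
# `Λ = ℤ_p⟦T⟧`-structure; EXISTENCE proved), the transpose `gX := loc_v^∨ : Q → Dψ.X`, its `Λ`-linearity, and `coker gX ≅ Sel_{str,v}^∨`

WIDTH seat `bsd-line-slh-p3-w3` g20 under LEAD `cruxlead-stmt-BirchSwinnertonDyer-23599` g9 (cell `bsd-ssimc`); BRIEF-E2 rev 3.1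
`Lines/rtt_w3-BRIEF-E2-g9b.md` §2 rows `Q`, `gX`, `coker gX`; sequel of `…RttD2SeqLocalCondition` (§0–§2: `localCondInftySat`, `locSat`, `strictAt`).
DEFINITIONS WITH BODIES AND PROVED API ONLY — no named fact, no `sorry`, no notation; the only instances are the structure-field projections of the hypothesis
structure `LocalCondDualData` (as the global `SignedTransportDualDataSat`); nothing about `λ`, `μ`, freeness or E2 itself is asserted; crux L, crux M, E2 and
BSD remain OPEN and are proved for NO curve by any of this.
* §3 `p`-primarity and local nilpotence of `conj_{γ_E} − 1` on `H¹(Gal(Ē/E_∞), N)` over ANY base field `E` (Greenberg's (P)/(A1)/(A2); the tree's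
  `GreenbergSelmer.exists_pow_smul_subgroupH1_eq_zero` / `exists_conjH1_pow_prime_pow_eq` carry a number-field section variable and `K_v` is not a number
  field — same proofs as `AcSigned.isLocNil_conjLocal_sub_one`, coefficients generalised), on any stable subgroup (`isLocNil_sub_one_of_coe_eq_conjH1`);
  `conjLocalSat`, ★ `isLocNil_conjLocalSat_sub_one` (needs `AcSigned.IsNonsplitIn κ v` — one prime of `K_∞` above `v` — and a local topological generator
  `γ_v ∈ Γ_{K_v}`, i.e. `κ(res_ι γ_v)` generates); the HYPOTHESIS STRUCTURE `LocalCondDualData κ M R V j ε v γ_v` (local twin, field for field, of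
  `SignedTransportDualDataSat`: `X`, `toDual : X ≅ Hom(E^{ε}_{sat,v}, ℚ/ℤ)`, `T ↦ conj_{γ_v} − 1`, constants through `ℤ_p → ℤ/p^k`; the glue's `Q := DQ.X`),
  its EXISTENCE `localCondDualData` (`X := Hom(E^{ε}_{sat,v}, ℚ/ℤ)`, `IwasawaDual.IsLocNil.module`), and the forcing `LocalCondDualData.toDual_smul_eq_smulFun`.
  (Design note: statements about `DQ.X` rather than the concrete `Hom(H¹-subgroup, ℚ/ℤ)` keep instance search off the categorical `H¹` carrier — the same
  reason the global side is unbundled — and make the tree's two-datum transpose `IwasawaDual.dualHom` apply verbatim.)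
* §4 `gXHom Dψ DQ := loc_v^∨ : DQ.X →+ Dψ.X` (`IwasawaDual.dualHom` through `Dψ.toDual`, `DQ.toDual`), `toDual_gXHom_apply`, `conjH1_eq_conjH1_resGalOfEmb` (`γ`,
  `res_ι γ_v` both topological generators ⇒ `conj_γ = conj_{res_ι γ_v}` on `H¹(K_∞, M)`), the intertwining `locSat_conjSignedSat_sub_one`, ★ `gXHom_smul`
  (`Λ`-linear, for EVERY `Dψ`, `DQ`: `IwasawaDual.dualHom_smul` + the two forcing lemmas), `gXLinearMap`.
* §5 ★ `nonempty_quotient_range_gXHom_addEquiv_strictAt_dual`: `Dψ.X ⧸ gX(Q) ≃+ Hom(Sel_{str,v}, ℚ/ℤ)` (exactness of `Hom(−, ℚ/ℤ)`, LEAD's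
  `nonempty_quotient_range_compHom'_addEquiv_ker`, `QuotientAddGroup.congr` along `Dψ.toDual`).
Part 3/3 (`…RttD2SeqLocalDualO`): the `R`-action on `E^{ε}_{sat,v}`, the `𝒪⟦T⟧`-structure on `DQ.X` and the `Λ_𝒪`-linearity of `gX`. NOT here: `Col`, `z`,
`hz`, `ker gX`, `hK` (rows (2′), (5′)–(7′)). References: [Kobayashi2003] Thm. 7.3 i); [GreenbergLNM1716] §1; [HatleyLeiVigni2022] §2.2, §3.1;
[Washington1997] §13.2; [Lang1990] Ch. 5 §1; [SerreLocalFields1979] VII.§5.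
-/

set_option autoImplicit false
set_option linter.dupNamespace false -- D-0017: single-problem summit, the namespace repeats the problem name by design
noncomputable section

open scoped Classical
open NumberField IsDedekindDomain Field

universe u

namespace Summit.BirchSwinnertonDyer.BirchSwinnertonDyer.Theorems.SmallImageRttD2Seq

open Literature.NumberTheory.EllipticCurves Literature.NumberTheory.EllipticCurves.Kobayashi2003
  Literature.NumberTheory.EllipticCurves.GreenbergVatsal2000 Literature.NumberTheory.GaloisRepresentations
  Summit.BirchSwinnertonDyer.BirchSwinnertonDyer.Theorems.SmallImageCharSignedSelmer

/-! ## §3. `p`-primarity and local nilpotence over a LOCAL base; the dual `Q := (E^{ε}_{sat,v})^∨` and its `Λ`-structure -/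

section LocalNilpotence

variable {E : Type u} [Field E] {p : ℕ} [Fact p.Prime] (κE : ZpExtension E p)
  (N : Type u) [AddCommGroup N] [DistribMulAction (absoluteGaloisGroup E) N] [TopologicalSpace N] [DiscreteTopology N]

/-- **(P) over any base field**: every class of `H¹(Gal(Ē/E_∞), N)` is killed by a power of `p` when `N` is `p`-primary (`Γ_E` and hence the closed
subgroup `Gal(Ē/E_∞)` are compact for EVERY field `E`, `absoluteGaloisGroup_compactSpace`; a continuous cocycle takes finitely many values). The tree's
`GreenbergSelmer.exists_pow_smul_subgroupH1_eq_zero` carries a number-field section variable; this is the same proof over a local base.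
[cite: GreenbergLNM1716, §1 (after Conj. 1.3)] -/
theorem exists_pow_smul_subgroupH1_eq_zero_local (htor : ∀ m : N, ∃ k : ℕ, p ^ k • m = 0) (c : subgroupH1 κE.kerSubgroup N) :
    ∃ k : ℕ, p ^ k • c = 0 := by
  haveI : CompactSpace (absoluteGaloisGroup E) := absoluteGaloisGroup_compactSpace E
  haveI : CompactSpace κE.kerSubgroup := isCompact_iff_compactSpace.mp κE.isClosed_kerSubgroup.isCompact
  obtain ⟨φ, rfl⟩ := oneCocycleClass_surjective _ c
  exact IwasawaDual.exists_pow_smul_oneCocycleClass_eq_zero φ fun σ ↦ htor (φ.1 σ)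

/-- **(A1)+(A2) over any base field**: for a topological generator `γ_E` of `κ_E` and `N` with open stabilisers, every class of `H¹(Gal(Ē/E_∞), N)` is fixed by
`conj_{γ_E^{p^a}}` for some `a` (the cocycle has finitely many values and vanishes near `1`, so an open normal subgroup `𝒩` fixes its class; `𝒩` has index
`p^a·e`, `p ∤ e`, and `γ_E^{p^a} ∈ g₀^{[Γ_E:𝒩]} · ker κ_E` with `κ_E(g₀) = e⁻¹`). Same proof as `AcSigned.isLocNil_conjLocal_sub_one`, coefficients generalised.
[cite: GreenbergLNM1716, §1 (after Conj. 1.3)] [cite: SerreLocalFields1979, VII.§5 Prop. 3] -/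
theorem exists_conjH1_pow_prime_pow_eq_local
    (hstab : ∀ m : N, IsOpen (MulAction.stabilizer (absoluteGaloisGroup E) m : Set (absoluteGaloisGroup E)))
    {γE : absoluteGaloisGroup E} (hγ : κE.IsTopGenerator γE) (c : subgroupH1 κE.kerSubgroup N) :
    ∃ a : ℕ, conjH1 κE.kerSubgroup N (γE ^ p ^ a) c = c := by
  haveI : CompactSpace (absoluteGaloisGroup E) := absoluteGaloisGroup_compactSpace E
  haveI : CompactSpace κE.kerSubgroup := isCompact_iff_compactSpace.mp κE.isClosed_kerSubgroup.isCompact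
  -- (A1): an open normal subgroup fixing the class
  have hA1 : ∃ Nrm : OpenNormalSubgroup (absoluteGaloisGroup E), ∀ τ ∈ Nrm, conjH1 κE.kerSubgroup N τ c = c := by
    obtain ⟨φ, rfl⟩ := oneCocycleClass_surjective _ c
    have hfin : (Set.range φ.1).Finite := (isCompact_range φ.1.continuous).finite_of_discrete
    set Ufix : Set (absoluteGaloisGroup E) := {τ | ∀ m ∈ Set.range φ.1, τ • m = m} with hUfix_def
    have hUfix : IsOpen Ufix := by
      have e : Ufix = ⋂ m ∈ Set.range φ.1, (MulAction.stabilizer (absoluteGaloisGroup E) m : Set (absoluteGaloisGroup E)) := by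
        ext τ
        simp only [hUfix_def, Set.mem_setOf_eq, Set.mem_iInter, SetLike.mem_coe, MulAction.mem_stabilizer_iff]
      rw [e]
      exact hfin.isOpen_biInter fun m _ ↦ hstab m
    have hz : IsOpen {h : κE.kerSubgroup | φ.1 h = 0} := (isOpen_discrete ({0} : Set N)).preimage φ.1.continuous
    obtain ⟨U0, hU0, hU0eq⟩ := isOpen_induced_iff.mp hz
    have h1fix : (1 : absoluteGaloisGroup E) ∈ Ufix := fun m _ ↦ one_smul _ m
    have h1U0 : (1 : absoluteGaloisGroup E) ∈ U0 := by
      have : (1 : κE.kerSubgroup) ∈ Subtype.val ⁻¹' U0 := by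
        rw [hU0eq]
        exact contOneCocycles.apply_one φ
      exact this
    obtain ⟨Nrm, hNrm⟩ := ProfiniteGrp.exist_openNormalSubgroup_sub_open_nhds_of_one (hUfix.inter hU0) ⟨h1fix, h1U0⟩
    refine ⟨Nrm, fun τ hτ ↦ IwasawaDual.conjH1_oneCocycleClass_eq φ (fun h ↦ ?_) (fun h n hn ↦ ?_)⟩
    · exact (hNrm hτ).1 _ ⟨h, rfl⟩
    · have hnN : (n : absoluteGaloisGroup E) ∈ Nrm := by
        rw [hn]
        have h1 : (h : absoluteGaloisGroup E)⁻¹ * τ⁻¹ * (h : absoluteGaloisGroup E)⁻¹⁻¹ ∈ Nrm.toSubgroup :=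
          Subgroup.Normal.conj_mem inferInstance _ (Nrm.toSubgroup.inv_mem hτ) _
        rw [inv_inv] at h1
        exact Nrm.toSubgroup.mul_mem h1 hτ
      have hn0 : n ∈ Subtype.val ⁻¹' U0 := (hNrm hnN).2
      rw [hU0eq] at hn0
      exact hn0
  -- (A2): a `p`-power of the generator lies in `Nrm · ker κ_E`
  obtain ⟨Nrm, hNrm⟩ := hA1
  haveI : Finite (absoluteGaloisGroup E ⧸ Nrm.toSubgroup) := Subgroup.quotient_finite_of_isOpen _ Nrm.isOpen
  have hd : Nrm.toSubgroup.index ≠ 0 := Subgroup.index_ne_zero_of_finite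
  obtain ⟨a, e, he, hde⟩ := Nat.exists_eq_pow_mul_and_not_dvd hd p (Fact.out : p.Prime).ne_one
  obtain ⟨u, hu⟩ := IwasawaDual.isUnit_natCast_padicInt (p := p) he
  obtain ⟨g₀, hg₀⟩ := κE.surjective (Multiplicative.ofAdd ((u⁻¹ : ℤ_[p]ˣ) : ℤ_[p]))
  have hg₀' : κE g₀ = Multiplicative.ofAdd ((u⁻¹ : ℤ_[p]ˣ) : ℤ_[p]) := hg₀
  have hτN : g₀ ^ Nrm.toSubgroup.index ∈ Nrm := Nrm.toSubgroup.pow_index_mem g₀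
  have hκτ : (κE (g₀ ^ Nrm.toSubgroup.index)).toAdd = (p : ℤ_[p]) ^ a := by
    rw [map_pow, hg₀', ← ofAdd_nsmul, toAdd_ofAdd, nsmul_eq_mul, hde, Nat.cast_mul, Nat.cast_pow, ← hu, mul_assoc, Units.mul_inv, mul_one]
  have hκγ : (κE (γE ^ p ^ a)).toAdd = (p : ℤ_[p]) ^ a := by
    rw [map_pow, show κE γE = Multiplicative.ofAdd 1 from hγ, ← ofAdd_nsmul, toAdd_ofAdd, nsmul_eq_mul, mul_one, Nat.cast_pow]
  have hh₀ : (g₀ ^ Nrm.toSubgroup.index)⁻¹ * γE ^ p ^ a ∈ κE.kerSubgroup := by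
    rw [ZpExtension.mem_kerSubgroup, map_mul, map_inv]
    apply Multiplicative.toAdd.injective
    rw [toAdd_mul, toAdd_inv, hκτ, hκγ, toAdd_one, neg_add_cancel]
  refine ⟨a, ?_⟩
  conv_lhs => rw [← mul_inv_cancel_left (g₀ ^ Nrm.toSubgroup.index) (γE ^ p ^ a)]
  rw [conjH1_mul_holds κE.kerSubgroup N, AddMonoidHom.comp_apply, conjH1_of_mem_holds κE.kerSubgroup N hh₀, AddMonoidHom.id_apply]
  exact hNrm _ hτN

/-- **Local nilpotence on a stable subgroup.** For a `conj_{γ_E}`-stable subgroup `Y ≤ H¹(Gal(Ē/E_∞), N)` (`N` `p`-primary with open stabilisers, `γ_E` a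
topological generator of `κ_E`): `Y` is `p`-primary and `conj_{γ_E} − 1` is locally nilpotent on it — the hypotheses `IwasawaDual.IsLocNil` making `Hom(Y, ℚ/ℤ)` a
`Λ = ℤ_p⟦T⟧`-module. [cite: GreenbergLNM1716, §1 (after Conj. 1.3)] -/
theorem isLocNil_sub_one_of_coe_eq_conjH1 (htor : ∀ m : N, ∃ k : ℕ, p ^ k • m = 0)
    (hstab : ∀ m : N, IsOpen (MulAction.stabilizer (absoluteGaloisGroup E) m : Set (absoluteGaloisGroup E)))
    {γE : absoluteGaloisGroup E} (hγ : κE.IsTopGenerator γE) {Y : AddSubgroup (subgroupH1 κE.kerSubgroup N)} (ψ : AddMonoid.End Y)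
    (hψ : ∀ y : Y, ((ψ y : Y) : subgroupH1 κE.kerSubgroup N) = conjH1 κE.kerSubgroup N γE y) :
    IwasawaDual.IsLocNil p (ψ - 1) := by
  have htor' : ∀ y : Y, ∃ k : ℕ, p ^ k • y = 0 := fun y ↦ by
    obtain ⟨k, hk⟩ := exists_pow_smul_subgroupH1_eq_zero_local κE N htor (y : subgroupH1 κE.kerSubgroup N)
    exact ⟨k, Subtype.ext (by rw [AddSubgroupClass.coe_nsmul]; exact hk)⟩
  have hpow : ∀ (m : ℕ) (y : Y), (((ψ ^ m) y : Y) : subgroupH1 κE.kerSubgroup N) = conjH1 κE.kerSubgroup N (γE ^ m) y := by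
    intro m
    induction m with
    | zero => intro y; rw [pow_zero, pow_zero, AddMonoid.End.one_apply, conjH1_one_holds κE.kerSubgroup N, AddMonoidHom.id_apply]
    | succ m ih =>
      intro y
      rw [pow_succ, AddMonoid.End.coe_mul, Function.comp_apply, ih, hψ, pow_succ, conjH1_mul_holds κE.kerSubgroup N,
        AddMonoidHom.comp_apply]
  refine ⟨htor', fun y ↦ ?_⟩
  obtain ⟨a, ha⟩ := exists_conjH1_pow_prime_pow_eq_local κE N hstab hγ (y : subgroupH1 κE.kerSubgroup N)
  obtain ⟨k, hk⟩ := htor' y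
  have hφ : (ψ ^ p ^ a) y = y := Subtype.ext (by rw [hpow]; exact ha)
  exact ⟨k * p ^ a, IwasawaDual.pow_mul_prime_pow_apply_eq_zero (Fact.out : p.Prime) _ a hφ hk⟩

end LocalNilpotence

section Dual

variable {K : Type u} [Field K] [NumberField K] {p : ℕ} [Fact p.Prime] (κ : ZpExtension K p)
  (M : Type u) [AddCommGroup M] [TopologicalSpace M] [DiscreteTopology M]
  (R : Type*) [Ring R] [Module R M]
  (V : WeierstrassCurve K) (j : V.geomPrimaryTorsion p →+ M) (ε : ℤˣ)
  (v : HeightOneSpectrum (𝓞 K)) [DistribMulAction (absoluteGaloisGroup (v.adicCompletion K)) M]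

/-- `conj_σ` (`σ ∈ Γ_{K_v}`) as an endomorphism of `E^{ε}_{sat,v}` (`conjH1_mem_localCondInftySat`). [cite: HatleyLeiVigni2022, Remark 3.1 (the `Λ`-action)] -/
def conjLocalSat (σ : absoluteGaloisGroup (v.adicCompletion K)) : AddMonoid.End (localCondInftySat κ M R V j ε v) :=
  haveI := normal_localSubgroupOfEmb_kerSubgroup κ v
  (((conjH1 (localSubgroupOfEmb κ.kerSubgroup (closureEmb (K := K) (v.adicCompletion K))) M σ).restrict
      (localCondInftySat κ M R V j ε v)).codRestrict (localCondInftySat κ M R V j ε v)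
    fun c ↦ conjH1_mem_localCondInftySat κ M R V j ε v σ c.2)

variable {κ M R V j ε v} in
/-- Unfolding `conjLocalSat`: on classes it is `conj_σ` (definitional). [cite: HatleyLeiVigni2022, Remark 3.1 (the `Λ`-action)] -/
@[simp] theorem coe_conjLocalSat_apply (σ : absoluteGaloisGroup (v.adicCompletion K)) (c : localCondInftySat κ M R V j ε v) :
    ((conjLocalSat κ M R V j ε v σ c : localCondInftySat κ M R V j ε v) : subgroupH1 (localSubgroupOfEmb κ.kerSubgroup (closureEmb (K := K) (v.adicCompletion K))) M) =
      haveI := normal_localSubgroupOfEmb_kerSubgroup κ v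
      conjH1 (localSubgroupOfEmb κ.kerSubgroup (closureEmb (K := K) (v.adicCompletion K))) M σ c :=
  rfl

/-- **`E^{ε}_{sat,v}` is `p`-primary and `T = γ_v − 1` is locally nilpotent on it**, for `M` `p`-primary with open stabilisers in `Γ_{K_v}`, `v` non-split in
`K_∞/K` (`AcSigned.IsNonsplitIn`: the local tower `κ_v = AcSigned.localizeAt κ v hv` is a `ℤ_p`-extension of `K_v` with `ker κ_v = Gal(K̄_v/K_∞·K_v)`
definitionally) and `γ_v ∈ Γ_{K_v}` a local topological generator (`κ(res_ι γ_v)` generates). §3's (P)/(A1)/(A2) on the stable subgroup `E^{ε}_{sat,v}`.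
[cite: GreenbergLNM1716, §1 (after Conj. 1.3)] [cite: HatleyLeiVigni2022, §2.2 and Remark 3.1] -/
theorem isLocNil_conjLocalSat_sub_one (htor : ∀ m : M, ∃ k : ℕ, p ^ k • m = 0)
    (hstab : ∀ m : M, IsOpen (MulAction.stabilizer (absoluteGaloisGroup (v.adicCompletion K)) m : Set (absoluteGaloisGroup (v.adicCompletion K))))
    (hv : AcSigned.IsNonsplitIn κ v) {γv : absoluteGaloisGroup (v.adicCompletion K)}
    (hγv : κ.IsTopGenerator (resGalOfEmb (closureEmb (K := K) (v.adicCompletion K)) γv)) :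
    IwasawaDual.IsLocNil p (conjLocalSat κ M R V j ε v γv - 1) :=
  isLocNil_sub_one_of_coe_eq_conjH1 (AcSigned.localizeAt κ v hv) M htor hstab
    ((ZpExtension.isTopGenerator_localize_iff κ _ hv γv).2 hγv) (conjLocalSat κ M R V j ε v γv) fun _ ↦ rfl

/-- **Pontryagin-dual data for `E^{ε}_{sat,v}`** (local twin of the global `SignedTransportDualDataSat`, field for field): a `Λ = ℤ_p⟦T⟧`-module `X` with a group
isomorphism `toDual : X ≅ Hom(E^{ε}_{sat,v}, ℚ/ℤ)` under which `T` acts as `conj_{γ_v} − 1` (`γ_v ∈ Γ_{K_v}`) and constants `c ∈ ℤ_p` act on `pᵏ`-torsion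
classes through `ℤ_p → ℤ/pᵏ`. The glue's `Q` is `DQ.X` (BRIEF-E2 rev 3.1 §2); EXISTENCE is `localCondDualData` below (so this is a convenience interface, not a
hypothesis of substance); unbundled so that the tree's transpose `IwasawaDual.dualHom` applies verbatim (§4). Freeness / rank one (`Col`) are NOT built in.
[cite: Kobayashi2003, Thm. 7.3 i)] [cite: HatleyLeiVigni2022, §3.1 (before Prop. 3.2)] -/
structure LocalCondDualData (γv : absoluteGaloisGroup (v.adicCompletion K)) where
  /-- The underlying type of the Iwasawa module `X = (E^{ε}_{sat,v})^∨`. -/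
  X : Type u
  /-- `X` is an abelian group. -/
  [addCommGroup : AddCommGroup X]
  /-- `X` is a `Λ = ℤ_p⟦T⟧`-module. -/
  [module : Module (IwasawaAlgebra p) X]
  /-- The identification of `X` with the character group `Hom(E^{ε}_{sat,v}, ℚ/ℤ)`. -/
  toDual : X →+ (localCondInftySat κ M R V j ε v →+ AddCircle (1 : ℚ))
  /-- `toDual` is a group isomorphism. -/
  bijective : Function.Bijective toDual
  /-- `T` acts as `γ_v − 1`: `(T·x)(c) = x(conj_{γ_v} c) − x(c)`. -/
  toDual_T_smul : ∀ (x : X) (c : localCondInftySat κ M R V j ε v),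
    toDual ((PowerSeries.X : IwasawaAlgebra p) • x) c = toDual x (conjLocalSat κ M R V j ε v γv c) - toDual x c
  /-- Constants `c ∈ ℤ_p` act on `pᵏ`-torsion classes through `ℤ_p → ℤ/pᵏ`. -/
  toDual_C_smul : ∀ (a : ℤ_[p]) (x : X) (c : localCondInftySat κ M R V j ε v) (k : ℕ), (p ^ k) • c = 0 →
    toDual (PowerSeries.C a • x) c = (PadicInt.toZModPow k a).val • toDual x c

attribute [instance] LocalCondDualData.addCommGroup LocalCondDualData.module

/-- **`Hom(E^{ε}_{sat,v}, ℚ/ℤ)` with its CONSTRUCTED `Λ`-structure (`IwasawaDual.IsLocNil.module` on `isLocNil_conjLocalSat_sub_one`; `T ↦ ∘(conj_{γ_v} − 1)`,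
constants through `ℤ_p → ℤ/p^k`) IS a `LocalCondDualData`** (`toDual = id`) — existence of the glue's `Q`, for `M` `p`-primary with open stabilisers in `Γ_{K_v}`,
`v` non-split in `K_∞/K`, `γ_v` a local topological generator. Local twin of `signedTransportDualDataSat`. [cite: GreenbergLNM1716, §1 (after Conj. 1.3)]
[cite: HatleyLeiVigni2022, §2.2 ("`γ_∞ ↦ 1 + X`") and §3.1] -/
def localCondDualData (htor : ∀ m : M, ∃ k : ℕ, p ^ k • m = 0)
    (hstab : ∀ m : M, IsOpen (MulAction.stabilizer (absoluteGaloisGroup (v.adicCompletion K)) m : Set (absoluteGaloisGroup (v.adicCompletion K))))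
    (hv : AcSigned.IsNonsplitIn κ v) {γv : absoluteGaloisGroup (v.adicCompletion K)}
    (hγv : κ.IsTopGenerator (resGalOfEmb (closureEmb (K := K) (v.adicCompletion K)) γv)) : LocalCondDualData κ M R V j ε v γv :=
  { X := localCondInftySat κ M R V j ε v →+ AddCircle (1 : ℚ)
    module := (isLocNil_conjLocalSat_sub_one κ M R V j ε v htor hstab hv hγv).module
    toDual := AddMonoidHom.id _
    bijective := Function.bijective_id
    toDual_T_smul := fun x c ↦ by
      show (isLocNil_conjLocalSat_sub_one κ M R V j ε v htor hstab hv hγv).smulFun PowerSeries.X x c = x _ - x c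
      rw [(isLocNil_conjLocalSat_sub_one κ M R V j ε v htor hstab hv hγv).smulFun_X_apply, IwasawaDual.End_sub_apply,
        AddMonoid.End.one_apply, map_sub]
    toDual_C_smul := fun a x c k hk ↦ by
      show (isLocNil_conjLocalSat_sub_one κ M R V j ε v htor hstab hv hγv).smulFun (PowerSeries.C a) x c = _
      exact (isLocNil_conjLocalSat_sub_one κ M R V j ε v htor hstab hv hγv).smulFun_C_apply a x hk }

/-- Hence local dual data EXIST (the glue's `Q` is available). [cite: HatleyLeiVigni2022, §3.1] -/
theorem nonempty_localCondDualData (htor : ∀ m : M, ∃ k : ℕ, p ^ k • m = 0)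
    (hstab : ∀ m : M, IsOpen (MulAction.stabilizer (absoluteGaloisGroup (v.adicCompletion K)) m : Set (absoluteGaloisGroup (v.adicCompletion K))))
    (hv : AcSigned.IsNonsplitIn κ v) {γv : absoluteGaloisGroup (v.adicCompletion K)}
    (hγv : κ.IsTopGenerator (resGalOfEmb (closureEmb (K := K) (v.adicCompletion K)) γv)) : Nonempty (LocalCondDualData κ M R V j ε v γv) :=
  ⟨localCondDualData κ M R V j ε v htor hstab hv hγv⟩

variable {κ M R V j ε v} in
/-- **The `Λ`-action of a local dual datum is forced**: `toDual (f • x) = f ⋆ toDual x` with `⋆` the canonical finite-sum action `IsLocNil.smulFun` of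
`ψ = conj_{γ_v} − 1` (the tree's forcing lemma `IwasawaDual.IsLocNil.map_smul_eq_smulFun`; local twin of the LEAD's `toDual_smul_eq_smulFun`).
[cite: GreenbergLNM1716, §1 (after Conj. 1.3)] -/
theorem LocalCondDualData.toDual_smul_eq_smulFun {γv : absoluteGaloisGroup (v.adicCompletion K)} (DQ : LocalCondDualData κ M R V j ε v γv)
    (htor : ∀ m : M, ∃ k : ℕ, p ^ k • m = 0)
    (hstab : ∀ m : M, IsOpen (MulAction.stabilizer (absoluteGaloisGroup (v.adicCompletion K)) m : Set (absoluteGaloisGroup (v.adicCompletion K))))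
    (hv : AcSigned.IsNonsplitIn κ v) (hγv : κ.IsTopGenerator (resGalOfEmb (closureEmb (K := K) (v.adicCompletion K)) γv))
    (f : IwasawaAlgebra p) (x : DQ.X) :
    DQ.toDual (f • x) = (isLocNil_conjLocalSat_sub_one κ M R V j ε v htor hstab hv hγv).smulFun f (DQ.toDual x) :=
  (isLocNil_conjLocalSat_sub_one κ M R V j ε v htor hstab hv hγv).map_smul_eq_smulFun DQ.toDual
    (fun x c ↦ by rw [DQ.toDual_T_smul x c, IwasawaDual.End_sub_apply, AddMonoid.End.one_apply, map_sub])
    (fun a x c k hk ↦ DQ.toDual_C_smul a x c k hk) f x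

end Dual

/-! ## §4. The transpose `gX := loc_v^∨ : Q → Dψ.X` -/

section Transpose

variable {K : Type u} [Field K] [NumberField K] {p : ℕ} [Fact p.Prime] {κ : ZpExtension K p} {γ : absoluteGaloisGroup K}
  {M : Type u} [AddCommGroup M] [DistribMulAction (absoluteGaloisGroup K) M] [TopologicalSpace M] [DiscreteTopology M]
  {R : Type*} [Ring R] [Module R M]
  {V : WeierstrassCurve K} {j : V.geomPrimaryTorsion p →+ M} {S₀ : Set (HeightOneSpectrum (𝓞 K))} {ε : ℤˣ}
  (D : SignedTransportDualDataSat κ γ M R V j S₀ ε)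
  {v : HeightOneSpectrum (𝓞 K)} [DistribMulAction (absoluteGaloisGroup (v.adicCompletion K)) M]
  {γv : absoluteGaloisGroup (v.adicCompletion K)} (DQ : LocalCondDualData κ M R V j ε v γv)
  (hres : ∀ (σ : absoluteGaloisGroup (v.adicCompletion K)) (m : M), σ • m = resGalOfEmb (closureEmb (K := K) (v.adicCompletion K)) σ • m)
  (hvp : (p : 𝓞 K) ∈ v.asIdeal)

/-- **`gX := loc_v^∨ : Q = DQ.X →+ Dψ.X`**, the transpose of `loc_v : Sel → E^{ε}_{sat,v}` through the identifications `Dψ.toDual`, `DQ.toDual` (the tree's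
`IwasawaDual.dualHom`, `x ↦ Dψ.toDual⁻¹ (DQ.toDual x ∘ loc_v)`) — the glue's `gX` (BRIEF-E2 rev 3.1 §2) as an additive map; `Λ`-linear by `gXHom_smul`
(`Λ_𝒪`-linear: sibling file, the LEAD's `dualHom_smul_iwasawaAlgebraO`). [cite: Kobayashi2003, Thm. 7.3 i)] [cite: Washington1997, §13.2] -/
def gXHom : DQ.X →+ D.X :=
  IwasawaDual.dualHom D.toDual D.bijective DQ.toDual (locSat κ M R V j S₀ ε v hres hvp)

/-- The defining identity of `gX`: `Dψ.toDual (gX x) s = DQ.toDual x (loc_v s)`. [cite: Washington1997, §13.2] -/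
theorem toDual_gXHom_apply (x : DQ.X) (s : signedTransportSelmerInftySat κ M R V j S₀ ε) :
    D.toDual (gXHom D DQ hres hvp x) s = DQ.toDual x (locSat κ M R V j S₀ ε v hres hvp s) :=
  IwasawaDual.toDual_dualHom_apply _ _ _ _ x s

omit [DistribMulAction (absoluteGaloisGroup (v.adicCompletion K)) M] in
/-- `conj_γ = conj_{res_ι γ_v}` on `H¹(K_∞, M)` when `γ` and `res_ι γ_v` are both topological generators of `κ` (`γ⁻¹ · res_ι γ_v ∈ Gal(K̄/K_∞)` acts trivially,
`conjH1_of_mem_holds`). [cite: SerreLocalFields1979, VII.§5 Prop. 3] -/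
theorem conjH1_eq_conjH1_resGalOfEmb (hγ : κ.IsTopGenerator γ) (hγv : κ.IsTopGenerator (resGalOfEmb (closureEmb (K := K) (v.adicCompletion K)) γv)) :
    conjH1 κ.kerSubgroup M γ = conjH1 κ.kerSubgroup M (resGalOfEmb (closureEmb (K := K) (v.adicCompletion K)) γv) := by
  have hmem : (resGalOfEmb (closureEmb (K := K) (v.adicCompletion K)) γv)⁻¹ * γ ∈ κ.kerSubgroup := by
    rw [ZpExtension.mem_kerSubgroup, map_mul, map_inv, show κ γ = Multiplicative.ofAdd 1 from hγ,
      show κ (resGalOfEmb (closureEmb (K := K) (v.adicCompletion K)) γv) = Multiplicative.ofAdd 1 from hγv, inv_mul_cancel]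
  conv_lhs => rw [← mul_inv_cancel_left (resGalOfEmb (closureEmb (K := K) (v.adicCompletion K)) γv) γ, conjH1_mul_holds κ.kerSubgroup M,
    conjH1_of_mem_holds κ.kerSubgroup M hmem, AddMonoidHom.comp_id]

/-- **`loc_v` intertwines `conj_γ − 1` on `Sel` with `conj_{γ_v} − 1` on `E^{ε}_{sat,v}`** when `γ` and `res_ι γ_v` are both topological generators of `κ`
(`conjH1_eq_conjH1_resGalOfEmb` + the naturality `locH1_comp_conjH1`). The input `hΦ`/`hΦψ` of the tree's `dualHom_smul` / the LEAD's `dualHom_smul_iwasawaAlgebraO`.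
[cite: NeukirchSchmidtWingberg2008, I.§5] -/
theorem locSat_conjSignedSat_sub_one (hγ : κ.IsTopGenerator γ)
    (hγv : κ.IsTopGenerator (resGalOfEmb (closureEmb (K := K) (v.adicCompletion K)) γv)) (s : signedTransportSelmerInftySat κ M R V j S₀ ε) :
    locSat κ M R V j S₀ ε v hres hvp ((conjSignedSat κ M R V j S₀ ε γ - 1) s) =
      (conjLocalSat κ M R V j ε v γv - 1) (locSat κ M R V j S₀ ε v hres hvp s) := by
  haveI := normal_localSubgroupOfEmb_kerSubgroup κ v
  refine Subtype.ext ?_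
  rw [IwasawaDual.End_sub_apply, IwasawaDual.End_sub_apply, AddMonoid.End.one_apply, AddMonoid.End.one_apply, map_sub,
    AddSubgroupClass.coe_sub, AddSubgroupClass.coe_sub, coe_locSat_apply, coe_locSat_apply, coe_conjLocalSat_apply, coe_locSat_apply,
    coe_conjSignedSat_apply, conjH1_eq_conjH1_resGalOfEmb hγ hγv, ← AddMonoidHom.comp_apply, locH1_comp_conjH1, AddMonoidHom.comp_apply]

/-- ★ **`gX = loc_v^∨` is `Λ = ℤ_p⟦T⟧`-linear**, for EVERY saturated dual datum `Dψ` and EVERY local dual datum `DQ` (both `Λ`-actions are forced to be the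
canonical ones: the LEAD's `toDual_smul_eq_smulFun`, `LocalCondDualData.toDual_smul_eq_smulFun`): the tree's `IwasawaDual.dualHom_smul` with the intertwining
`locSat_conjSignedSat_sub_one`. [cite: GreenbergLNM1716, §1 (p. 60)] [cite: Washington1997, §13.2] -/
theorem gXHom_smul (htor : ∀ m : M, ∃ k : ℕ, p ^ k • m = 0)
    (hstabK : ∀ m : M, IsOpen (MulAction.stabilizer (absoluteGaloisGroup K) m : Set (absoluteGaloisGroup K)))
    (hstab : ∀ m : M, IsOpen (MulAction.stabilizer (absoluteGaloisGroup (v.adicCompletion K)) m : Set (absoluteGaloisGroup (v.adicCompletion K))))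
    (hγ : κ.IsTopGenerator γ) (hv : AcSigned.IsNonsplitIn κ v) (hγv : κ.IsTopGenerator (resGalOfEmb (closureEmb (K := K) (v.adicCompletion K)) γv))
    (f : IwasawaAlgebra p) (x : DQ.X) :
    gXHom D DQ hres hvp (f • x) = f • gXHom D DQ hres hvp x :=
  IwasawaDual.dualHom_smul D.toDual D.bijective DQ.toDual (locSat κ M R V j S₀ ε v hres hvp)
    (isLocNil_conjSignedSat_sub_one κ R V j S₀ ε htor hstabK hγ) (isLocNil_conjLocalSat_sub_one κ M R V j ε v htor hstab hv hγv)
    (fun f y ↦ toDual_smul_eq_smulFun D htor hstabK hγ f y) (fun f y ↦ DQ.toDual_smul_eq_smulFun htor hstab hv hγv f y)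
    (fun s ↦ locSat_conjSignedSat_sub_one hres hvp hγ hγv s) f x

/-- **`gX` as a `Λ`-linear map** (`gXHom` with `gXHom_smul`), for consumers working over `Λ = ℤ_p⟦T⟧`. [cite: GreenbergLNM1716, §1 (p. 60)] -/
def gXLinearMap (htor : ∀ m : M, ∃ k : ℕ, p ^ k • m = 0)
    (hstabK : ∀ m : M, IsOpen (MulAction.stabilizer (absoluteGaloisGroup K) m : Set (absoluteGaloisGroup K)))
    (hstab : ∀ m : M, IsOpen (MulAction.stabilizer (absoluteGaloisGroup (v.adicCompletion K)) m : Set (absoluteGaloisGroup (v.adicCompletion K))))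
    (hγ : κ.IsTopGenerator γ) (hv : AcSigned.IsNonsplitIn κ v) (hγv : κ.IsTopGenerator (resGalOfEmb (closureEmb (K := K) (v.adicCompletion K)) γv)) :
    DQ.X →ₗ[IwasawaAlgebra p] D.X where
  toFun := gXHom D DQ hres hvp
  map_add' := map_add _
  map_smul' f x := gXHom_smul D DQ hres hvp htor hstabK hstab hγ hv hγv f x

/-- `gXLinearMap` is `gXHom` on elements. [cite: GreenbergLNM1716, §1 (p. 60)] -/
@[simp] theorem gXLinearMap_apply (htor : ∀ m : M, ∃ k : ℕ, p ^ k • m = 0)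
    (hstabK : ∀ m : M, IsOpen (MulAction.stabilizer (absoluteGaloisGroup K) m : Set (absoluteGaloisGroup K)))
    (hstab : ∀ m : M, IsOpen (MulAction.stabilizer (absoluteGaloisGroup (v.adicCompletion K)) m : Set (absoluteGaloisGroup (v.adicCompletion K))))
    (hγ : κ.IsTopGenerator γ) (hv : AcSigned.IsNonsplitIn κ v) (hγv : κ.IsTopGenerator (resGalOfEmb (closureEmb (K := K) (v.adicCompletion K)) γv))
    (x : DQ.X) : gXLinearMap D DQ hres hvp htor hstabK hstab hγ hv hγv x = gXHom D DQ hres hvp x :=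
  rfl

end Transpose

/-! ## §5. `coker gX ≅ Sel_{str,v}^∨` (exactness of Pontryagin duality) -/

section Coker

variable {K : Type u} [Field K] [NumberField K] {p : ℕ} [Fact p.Prime] {κ : ZpExtension K p} {γ : absoluteGaloisGroup K}
  {M : Type u} [AddCommGroup M] [DistribMulAction (absoluteGaloisGroup K) M] [TopologicalSpace M] [DiscreteTopology M]
  {R : Type*} [Ring R] [Module R M]
  {V : WeierstrassCurve K} {j : V.geomPrimaryTorsion p →+ M} {S₀ : Set (HeightOneSpectrum (𝓞 K))} {ε : ℤˣ}
  (D : SignedTransportDualDataSat κ γ M R V j S₀ ε)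
  {v : HeightOneSpectrum (𝓞 K)} [DistribMulAction (absoluteGaloisGroup (v.adicCompletion K)) M]
  {γv : absoluteGaloisGroup (v.adicCompletion K)} (DQ : LocalCondDualData κ M R V j ε v γv)
  (hres : ∀ (σ : absoluteGaloisGroup (v.adicCompletion K)) (m : M), σ • m = resGalOfEmb (closureEmb (K := K) (v.adicCompletion K)) σ • m)
  (hvp : (p : 𝓞 K) ∈ v.asIdeal)

/-- Through `Dψ.toDual`, the image of `gX = loc_v^∨` is the image of precomposition with `loc_v` on characters: `toDual(gX(Q)) = loc_v⋆(Hom(E^{ε}_{sat,v}, ℚ/ℤ))`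
(`DQ.toDual` is onto). [cite: Washington1997, §13.2] -/
theorem map_toDual_range_gXHom :
    (gXHom D DQ hres hvp).range.map ((AddEquiv.ofBijective D.toDual D.bijective : D.X ≃+ _) : D.X →+ _) =
      (AddMonoidHom.compHom' (P := AddCircle (1 : ℚ)) (locSat κ M R V j S₀ ε v hres hvp)).range := by
  ext χ
  constructor
  · rintro ⟨y, ⟨x, rfl⟩, rfl⟩
    refine ⟨DQ.toDual x, ?_⟩
    ext s
    change DQ.toDual x (locSat κ M R V j S₀ ε v hres hvp s) = D.toDual (gXHom D DQ hres hvp x) s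
    rw [toDual_gXHom_apply]
  · rintro ⟨q, rfl⟩
    obtain ⟨x, rfl⟩ := DQ.bijective.2 q
    refine ⟨gXHom D DQ hres hvp x, ⟨x, rfl⟩, ?_⟩
    ext s
    change D.toDual (gXHom D DQ hres hvp x) s = DQ.toDual x (locSat κ M R V j S₀ ε v hres hvp s)
    rw [toDual_gXHom_apply]

/-- ★ **`coker gX ≅ Sel_{str,v}^∨`**: the cokernel of `gX = loc_v^∨ : Q → Dψ.X` is isomorphic, as a group, to the Pontryagin dual of `Sel_{str,v} = ker loc_v`:
`Dψ.X ⧸ gX(Q) ≅ Hom(Sel, ℚ/ℤ) ⧸ loc_v⋆(Hom(E^{ε}_{sat,v}, ℚ/ℤ)) ≅ Hom(ker loc_v, ℚ/ℤ)` by the exactness of `Hom(−, ℚ/ℤ)` and the injectivity of `ℚ/ℤ` (LEAD's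
`nonempty_quotient_range_compHom'_addEquiv_ker`, p776380). Row `coker gX = Sel_str^∨` of BRIEF-E2 rev 3.1 §2 (Kobayashi's `𝒳/Im = Sel_0^∨`); the
`λ`-invariant is transported along it by the LEAD's `lambdaInvariant_eq_of_addEquiv` / quasi-isomorphism toolkit.
[cite: Kobayashi2003, Thm. 7.3 i)] [cite: Washington1997, §13.2] -/
theorem nonempty_quotient_range_gXHom_addEquiv_strictAt_dual :
    Nonempty ((D.X ⧸ (gXHom D DQ hres hvp).range) ≃+ (strictAt κ M R V j S₀ ε v hres hvp →+ AddCircle (1 : ℚ))) := by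
  obtain ⟨e₂⟩ := SmallImageRttCharRoad.nonempty_quotient_range_compHom'_addEquiv_ker (locSat κ M R V j S₀ ε v hres hvp)
  exact ⟨(QuotientAddGroup.congr (gXHom D DQ hres hvp).range _ (AddEquiv.ofBijective D.toDual D.bijective)
    (map_toDual_range_gXHom D DQ hres hvp)).trans e₂⟩

end Coker

end Summit.BirchSwinnertonDyer.BirchSwinnertonDyer.Theorems.SmallImageRttD2Seq

end
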